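import Mathlib.GroupTheory.FiniteAbelian.Duality
import Mathlib.RingTheory.RootsOfUnity.AlgebraicallyClosed
import Mathlib.RingTheory.RootsOfUnity.Complex
import Mathlib.Analysis.Complex.Polynomial.Basic
import HarnessLib

/-!
# Crux `FrobeniusLadder.FRationalResolution` (stmt-ResolutionOfSingularities-15317), line `redirect`,
# stub `stub_diagonalizableQuotientResolution` — item (F2c), group-theoretic core: `ℤ/N`-valued characters of a finite abelian
# group (Pontryagin duality through `ℂ`), the input for splitting off the root degree after a root adjunction

The multi-root recipe (MEMO-15317-leafhand2-g22) regrades a chart by the pushout `A' = (A × ℤ/(nd))/⟨(b, −d)⟩` (`n = ord b`),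
adjoins `w^d = u` (`deg u = b`), and must then split off the cyclic unit degree `a = [(0,1)]` of `w`: a complement of `⟨a⟩` in
`A'` is the graph `{[(i, s i)]}` of an additive `s : A →+ ℤ/(nd)` with `s b = −d`. Such characters come from duality; this file
starts the supply:

* `exists_addMonoidHom_zmod_apply_ne_zero` — for a finite abelian `G` with `exp G ∣ N` and `x ≠ 0` there is `s : G →+ ZMod N`
  with `s x ≠ 0` (Mathlib's `ℂˣ`-valued separation `CommGroup.exists_apply_ne_one_of_hasEnoughRootsOfUnity`, read through the
  discrete logarithm `IsPrimitiveRoot.zmodEquivZPowers` of a primitive `N`-th root of unity).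

Honest label: helper toward ONE leaf stub; no stub, crux or summit closed. No definitions, no named facts, no sorry. [folklore]
-/

noncomputable section

-- single-problem summit: the doubled namespace component is forced
set_option linter.dupNamespace false

open Complex

namespace Summit.ResolutionOfSingularities.ResolutionOfSingularities.Theorems.FRationalResolution.ZModCharacters

/-- **`ℤ/N`-valued characters separate points** of a finite abelian group of exponent dividing `N`.
(Pontryagin duality, via `ℂ`-valued characters and a primitive `N`-th root of unity.) [folklore] -/
theorem exists_addMonoidHom_zmod_apply_ne_zero {G : Type} [AddCommGroup G] [Finite G] (N : ℕ) [NeZero N]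
    (hN : AddMonoid.exponent G ∣ N) {x : G} (hx : x ≠ 0) : ∃ s : G →+ ZMod N, s x ≠ 0 := by
  -- `ℂ` has enough roots of unity of order the exponent
  haveI : NeZero (Monoid.exponent (Multiplicative G) : ℂ) :=
    ⟨Nat.cast_ne_zero.2 Monoid.exponent_ne_zero_of_finite⟩
  obtain ⟨φ, hφ⟩ := CommGroup.exists_apply_ne_one_of_hasEnoughRootsOfUnity (Multiplicative G) ℂ
    (a := Multiplicative.ofAdd x) (by simpa using hx)
  -- a primitive `N`-th root of unity in `ℂˣ`
  have hζ₀ : IsPrimitiveRoot (exp (2 * Real.pi * I / N)) N := Complex.isPrimitiveRoot_exp N (NeZero.ne N)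
  set ζ : ℂˣ := (hζ₀.isUnit (NeZero.ne N)).unit with hζdef
  have hζ : IsPrimitiveRoot ζ N := hζ₀.isUnit_unit (NeZero.ne N)
  -- every value of `φ` is an `N`-th root of unity, hence a power of `ζ`
  have hmem : ∀ g : G, φ (Multiplicative.ofAdd g) ∈ Subgroup.zpowers ζ := by
    intro g
    rw [hζ.zpowers_eq, _root_.mem_rootsOfUnity, ← map_pow, ← ofAdd_nsmul]
    have h : N • g = 0 := by
      obtain ⟨m, hm⟩ := hN
      rw [hm, mul_comm, mul_nsmul, AddMonoid.exponent_nsmul_eq_zero]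
    rw [h, ofAdd_zero, map_one]
  let e := hζ.zmodEquivZPowers
  let s : G →+ ZMod N :=
    { toFun := fun g => e.symm (Additive.ofMul ⟨φ (Multiplicative.ofAdd g), hmem g⟩)
      map_zero' := by
        rw [← map_zero e.symm]
        congr 1
        apply Additive.toMul.injective
        apply Subtype.ext
        simp
      map_add' := fun g h => by
        rw [← map_add e.symm]
        congr 1
        apply Additive.toMul.injective
        apply Subtype.ext
        simp [ofAdd_add, map_mul] }
  refine ⟨s, fun h0 => hφ ?_⟩
  have h1 : (Additive.ofMul (⟨φ (Multiplicative.ofAdd x), hmem x⟩ : Subgroup.zpowers ζ)) = 0 := by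
    have := congrArg e h0
    simpa [s] using this
  have h2 := congrArg (fun y : Additive (Subgroup.zpowers ζ) => ((Additive.toMul y : Subgroup.zpowers ζ) : ℂˣ)) h1
  simpa using h2

end Summit.ResolutionOfSingularities.ResolutionOfSingularities.Theorems.FRationalResolution.ZModCharacters

end
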